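import Summits.MatrixMultiplication.MatrixMultiplication.Theorems.OutsiderSandwichTightSubrank
import Summits.MatrixMultiplication.MatrixMultiplication.Theorems.FarEdgeDescentSignStarSRank
import Literature.Computability.AlgebraicComplexity.LaserComponentTools
import HarnessLib

/-!
# Stratum pinning, core: a `Q̃ ≥ 4` engine for 8-point tight supports, and the supports of the weighted stars

Route `FarEdgeDescent` (cell `decomp-mm`, lens 2 «structural dichotomy (special vs generic)»,
gen 33), Kernel VIII-b, part 1 of 2; support for the aside `SubLogRate`
(stmt-MatrixMultiplication-25371).  Consumed by `FarEdgeDescentStratumPinning`.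

1. `four_le_asymptoticSubrank_of_tables` — a small engine on top of lens-4's Strassen bound
   `OutsiderSandwichTightSubrank.le_asymptoticSubrank_of_tight`: a tensor on `4 × 4 × 4` index sets
   whose support is an 8-point TIGHT set (injective integer labels summing to zero on it) all of
   whose rows, in each of the three directions, have exactly 2 points, has `Q̃ ≥ 4` — the uniform
   distribution on the support has uniform marginals (entropy `2`) and is a product on the support
   (max-entropy penalty `0`).  `asymptoticSubrank_le_card`: the matching upper pin `Q̃ ≤ |ι|`.
2. The supports of the two twist shapes of the same-support stratum of `⟨2,2,2⟩` in the route's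
   two-leaf coordinates (`FarEdgeDescentSignTwistCore.weightedStar/weightedTStar`, weights `w`
   nowhere zero): `weightedStar_ne_zero_iff` (`supp 𝔖^w = starSupp`), `weightedTStar_ne_zero_iff`
   (`supp 𝔖^{wᵀ} = tstarSupp`), explicit tight labellings `starα/β/γ`, `tstarα/β/γ`
   (`star_tight`, `tstar_tight`, injective, bounded), `|supp| = 8`, and the 2-point row counts —
   all the finite checks by `decide`.

References: V. Strassen, *Degeneration and complexity of bilinear maps*, J. reine angew. Math. 413
(1991) [Strassen1991]; M. Christandl, P. Vrana, J. Zuiddam, *Universal points in the asymptotic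
spectrum of tensors*, J. AMS 36 (2023), Thm. 4.4 of arXiv:1709.07851 [ChristandlVranaZuiddam2023];
P. Bürgisser, M. Clausen, M. A. Shokrollahi, *Algebraic Complexity Theory* (1997), Def. (15.34)
[BurgisserClausenShokrollahi1997]; M. Bläser, M. Christandl, J. Zuiddam, *The border support rank
of two-by-two matrix multiplication is seven*, 2018, §2 [BlaserChristandlZuiddam2017].
-/
noncomputable section

open scoped BigOperators

set_option linter.dupNamespace false

-- the nested `DecidableEq ((Fin 2 × Fin 1 ⊕ Fin 2 × Fin 1) × (Fin 2 × Fin 2) × _)` instance term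
-- exceeds the default synthesis size bound
set_option synthInstance.maxSize 2048

namespace Summit.MatrixMultiplication.MatrixMultiplication.Theorems.FarEdgeDescentStratumPinning

open Literature.Computability.AlgebraicComplexity
open Literature.Barriers.MatrixMultiplication (subrank_kroneckerPow_le_card_pow)
open Summit.MatrixMultiplication.MatrixMultiplication.Theorems.OutsiderSandwichTightSubrank
open Summit.MatrixMultiplication.MatrixMultiplication.Theorems.FarEdgeDescentSignTwist
open Summit.MatrixMultiplication.MatrixMultiplication.Theorems.FarEdgeDescentSignStarSRank

universe u
/-! ## 1. The engine: an 8-point tight support with 2-point rows on `4 × 4 × 4` gives `Q̃ ≥ 4` -/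

section Engine

variable {ι κ μ : Type} [Fintype ι] [Fintype κ] [Fintype μ] [DecidableEq ι] [DecidableEq κ]
  [DecidableEq μ]

/-- The count vector: indicator of `S`. [folklore] -/
def cnt (S : Finset (ι × κ × μ)) (s : ι × κ × μ) : ℕ := if s ∈ S then 1 else 0

/-- The uniform distribution `cnt / 8` on an 8-point set `S`. [folklore] -/
def unif (S : Finset (ι × κ × μ)) (s : ι × κ × μ) : ℝ := (cnt S s : ℝ) / 8

omit [Fintype ι] [Fintype κ] [Fintype μ] in
/-- `cnt` vanishes off `S`. [folklore] -/
theorem cnt_eq_zero (S : Finset (ι × κ × μ)) (s : ι × κ × μ) (hs : s ∉ S) : cnt S s = 0 := by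
  simp [cnt, hs]

/-- `∑ cnt = |S|`. [folklore] -/
theorem sum_cnt (S : Finset (ι × κ × μ)) : ∑ s, cnt S s = S.card := by
  simp only [cnt, Finset.sum_boole, Nat.cast_id, Finset.filter_mem_eq_inter, Finset.univ_inter]

omit [Fintype ι] [Fintype κ] [Fintype μ] in
/-- `unif = cnt / 8` in the form the counting theorem wants. [folklore] -/
theorem unif_eq (S : Finset (ι × κ × μ)) (s : ι × κ × μ) :
    unif S s = (cnt S s : ℝ) / ((8 : ℕ) : ℝ) := by
  simp [unif]

omit [Fintype ι] [Fintype κ] [Fintype μ] in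
/-- `unif = 1/8` on `S`. [folklore] -/
theorem unif_of_mem (S : Finset (ι × κ × μ)) {s : ι × κ × μ} (hs : s ∈ S) : unif S s = 1 / 8 := by
  simp [unif, cnt, hs]

omit [Fintype ι] [Fintype κ] [Fintype μ] in
/-- `unif = 0` off `S`. [folklore] -/
theorem unif_of_not_mem (S : Finset (ι × κ × μ)) (s : ι × κ × μ) (hs : s ∉ S) : unif S s = 0 := by
  simp [unif, cnt, hs]

omit [Fintype ι] [Fintype κ] [Fintype μ] in
/-- `unif` as an indicator. [folklore] -/
theorem unif_apply (S : Finset (ι × κ × μ)) (s : ι × κ × μ) :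
    unif S s = if s ∈ S then 1 / 8 else 0 := by
  by_cases h : s ∈ S
  · rw [if_pos h, unif_of_mem S h]
  · rw [if_neg h, unif_of_not_mem S s h]

omit [Fintype ι] [Fintype κ] [Fintype μ] in
/-- `0 ≤ unif`. [folklore] -/
theorem unif_nonneg (S : Finset (ι × κ × μ)) (s : ι × κ × μ) : 0 ≤ unif S s := by
  unfold unif; positivity

/-- `∑ unif = 1` when `|S| = 8`. [folklore] -/
theorem sum_unif (S : Finset (ι × κ × μ)) (hcard : S.card = 8) : ∑ s, unif S s = 1 := by
  simp only [unif]
  rw [← Finset.sum_div, ← Nat.cast_sum, sum_cnt, hcard]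
  norm_num

/-- `H(uniform on a 4-set) = 2`. [folklore] -/
theorem shannonEntropy_quarter {α : Type} [Fintype α] (h : Fintype.card α = 4) :
    shannonEntropy (fun _ : α => (1 / 4 : ℝ)) = 2 := by
  rw [shannonEntropy_def, Finset.sum_const, Finset.card_univ, h, nsmul_eq_mul]
  have hl : Real.log 2 ≠ 0 := (Real.log_pos one_lt_two).ne'
  have e : Real.negMulLog (1 / 4 : ℝ) = Real.log 2 / 2 := by
    rw [Real.negMulLog, one_div, Real.log_inv, show (4 : ℝ) = 2 ^ 2 by norm_num, Real.log_pow]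
    push_cast
    ring
  rw [e]
  field_simp
  push_cast
  ring

/-- **The engine.** On index sets of size `4`, a tensor whose support is an 8-point tight set
(injective integer labels `α, β, γ` with `α + β + γ = 0` on it) with exactly 2 points in every row of
every direction has `Q̃ ≥ 4`: Strassen's bound `2^{min_m H(P_m) − Γ}` (lens-4's
`le_asymptoticSubrank_of_tight`) for the uniform distribution, whose marginals are uniform
(entropy `2`) and which is a product on the support (penalty `0`). [cite: Strassen1991, Thm. (laser method for tight sets); ChristandlVranaZuiddam2023, Thm. 4.4] -/
theorem four_le_asymptoticSubrank_of_tables (hι : Fintype.card ι = 4) (hκ : Fintype.card κ = 4)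
    (hμ : Fintype.card μ = 4) (t : ι → κ → μ → ℂ) (S : Finset (ι × κ × μ))
    (hsupp : ∀ a b c, t a b c ≠ 0 ↔ (a, b, c) ∈ S)
    (α : ι → ℤ) (β : κ → ℤ) (γ : μ → ℤ) (hα : Function.Injective α)
    (hβ : Function.Injective β) (hγ : Function.Injective γ) {b : ℕ} (hαb : ∀ a, |α a| ≤ b)
    (hβb : ∀ x, |β x| ≤ b) (htight : ∀ s ∈ S, α s.1 + β s.2.1 + γ s.2.2 = 0)
    (hcard : S.card = 8)
    (hrow₁ : ∀ a, (Finset.univ.filter fun bc : κ × μ => (a, bc.1, bc.2) ∈ S).card = 2)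
    (hrow₂ : ∀ x, (Finset.univ.filter fun ac : ι × μ => (ac.1, x, ac.2) ∈ S).card = 2)
    (hrow₃ : ∀ c, (Finset.univ.filter fun ab : ι × κ => (ab.1, ab.2, c) ∈ S).card = 2) :
    (4 : ℝ) ≤ asymptoticSubrank ℂ t := by
  classical
  -- marginals of the uniform distribution
  have m₁ : marginalDist₁ (unif S) = fun _ => 1 / 4 := by
    funext a
    simp only [marginalDist₁]
    rw [(Fintype.sum_prod_type' fun b c => unif S (a, b, c)).symm]
    simp only [unif_apply]
    rw [← Finset.sum_filter, Finset.sum_const, nsmul_eq_mul, hrow₁ a]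
    norm_num
  have m₂ : marginalDist₂ (unif S) = fun _ => 1 / 4 := by
    funext x
    simp only [marginalDist₂]
    rw [(Fintype.sum_prod_type' fun a c => unif S (a, x, c)).symm]
    simp only [unif_apply]
    rw [← Finset.sum_filter, Finset.sum_const, nsmul_eq_mul, hrow₂ x]
    norm_num
  have m₃ : marginalDist₃ (unif S) = fun _ => 1 / 4 := by
    funext c
    simp only [marginalDist₃]
    rw [(Fintype.sum_prod_type' fun a b => unif S (a, b, c)).symm]
    simp only [unif_apply]
    rw [← Finset.sum_filter, Finset.sum_const, nsmul_eq_mul, hrow₃ c]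
    norm_num
  -- no penalty: product form on the support
  have pen : maxEntropyPenalty S (unif S) = 0 :=
    maxEntropyPenalty_eq_zero_of_mul S ⟨unif_nonneg S, sum_unif S hcard⟩ (unif_of_not_mem S)
      (fun _ => 1 / 8) (fun _ => 1) (fun _ => 1) (fun _ _ => by norm_num) (fun _ _ => one_pos)
      (fun _ _ => one_pos) (fun s hs => by rw [unif_of_mem S hs]; ring)
  have hsum : ∑ s, cnt S s = 8 := by rw [sum_cnt, hcard]
  have h := le_asymptoticSubrank_of_tight t S (fun a b c h => (hsupp a b c).1 h)
    (fun s hs => (hsupp s.1 s.2.1 s.2.2).2 (by simpa using hs))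
    (fun a (_ : Fin 1) => α a) (fun x (_ : Fin 1) => β x) (fun c (_ : Fin 1) => γ c)
    (fun _ _ h => hα (congrFun h 0)) (fun _ _ h => hβ (congrFun h 0))
    (fun _ _ h => hγ (congrFun h 0)) (fun a _ => hαb a) (fun x _ => hβb x)
    (fun s hs _ => htight s hs) (cnt S) (cnt_eq_zero S) (d := 8) (by norm_num) hsum (unif S)
    (unif_eq S)
  rw [m₁, m₂, m₃, shannonEntropy_quarter hι, shannonEntropy_quarter hκ, shannonEntropy_quarter hμ,
    pen, min_self, min_self, sub_zero, Real.rpow_two] at h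
  norm_num at h
  exact h

omit [DecidableEq ι] [DecidableEq κ] [DecidableEq μ] in
/-- **`Q̃(t) ≤ |ι|`** (`Q(t^{⊗N}) ≤ |ι|^N`; the upper pin). [cite: ChristandlVranaZuiddam2023, §1.1] -/
theorem asymptoticSubrank_le_card (t : ι → κ → μ → ℂ) :
    asymptoticSubrank ℂ t ≤ Fintype.card ι := by
  classical
  unfold asymptoticSubrank
  refine ciSup_le fun m => ?_
  have hq : ((subrank ℂ (kroneckerPow t (m + 1)) : ℝ)) ≤ (Fintype.card ι : ℝ) ^ (m + 1) := by
    exact_mod_cast subrank_kroneckerPow_le_card_pow t (m + 1)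
  have hm : (0 : ℝ) ≤ ((m : ℝ) + 1)⁻¹ := by positivity
  calc ((subrank ℂ (kroneckerPow t (m + 1)) : ℝ)) ^ (((m : ℝ) + 1)⁻¹)
      ≤ ((Fintype.card ι : ℝ) ^ (m + 1)) ^ (((m : ℝ) + 1)⁻¹) :=
        Real.rpow_le_rpow (Nat.cast_nonneg _) hq hm
    _ = Fintype.card ι := by
        rw [← Nat.cast_succ, Real.pow_rpow_inv_natCast (Nat.cast_nonneg _) (Nat.succ_ne_zero m)]

end Engine

/-! ## 2. The two supports on the stratum and their tight labellings -/

section Supports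

/-- The middle index set `Fin 2 × Fin 2` (the matrix slot `X`). [folklore] -/
abbrev Mid := Fin 2 × Fin 2

/-- Support pattern of a weighted star `𝔖^w` (`w` nowhere zero): `(inl i, (i,j), inl j)` and
`(inr i, (i,j), inr j)`. [cite: BlaserChristandlZuiddam2017, §2] -/
def starB : Leaf → Mid → Leaf → Bool
  | Sum.inl a, b, Sum.inl c => decide (a.1 = b.1 ∧ b.2 = c.1)
  | Sum.inr a, b, Sum.inr c => decide (a.1 = b.1 ∧ b.2 = c.1)
  | _, _, _ => false

/-- Support pattern of a transposed weighted star `𝔖^{wᵀ}`: `(inl i, (i,j), inl j)` and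
`(inr i, (j,i), inr j)`. [cite: CohnUmans2013, §3] -/
def tstarB : Leaf → Mid → Leaf → Bool
  | Sum.inl a, b, Sum.inl c => decide (a.1 = b.1 ∧ b.2 = c.1)
  | Sum.inr a, b, Sum.inr c => decide (a.1 = b.2 ∧ b.1 = c.1)
  | _, _, _ => false

/-- The support of `𝔖^w` as a finite set (8 points). [cite: BlaserChristandlZuiddam2017, §2] -/
def starSupp : Finset (Leaf × Mid × Leaf) :=
  Finset.univ.filter fun s => starB s.1 s.2.1 s.2.2 = true

/-- The support of `𝔖^{wᵀ}` as a finite set (8 points). [cite: CohnUmans2013, §3] -/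
def tstarSupp : Finset (Leaf × Mid × Leaf) :=
  Finset.univ.filter fun s => tstarB s.1 s.2.1 s.2.2 = true

/-- Membership in `starSupp`. [folklore] -/
theorem mem_starSupp (a : Leaf) (b : Mid) (c : Leaf) :
    (a, b, c) ∈ starSupp ↔ starB a b c = true := by
  simp [starSupp]

/-- Membership in `tstarSupp`. [folklore] -/
theorem mem_tstarSupp (a : Leaf) (b : Mid) (c : Leaf) :
    (a, b, c) ∈ tstarSupp ↔ tstarB a b c = true := by
  simp [tstarSupp]

/-- **`supp 𝔖^w = starSupp`** for `w` nowhere zero. [cite: BlaserChristandlZuiddam2017, §2] -/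
theorem weightedStar_ne_zero_iff {w : Mid → ℂ} (hw : ∀ b, w b ≠ 0) (a : Leaf) (b : Mid) (c : Leaf) :
    weightedStar ℂ 2 1 w a b c ≠ 0 ↔ (a, b, c) ∈ starSupp := by
  rw [mem_starSupp]
  obtain ⟨x₁, x₂⟩ := b
  rcases a with ⟨i, l⟩ | ⟨i, l⟩ <;> rcases c with ⟨k, l'⟩ | ⟨k, l'⟩
  · rw [weightedStar_inl_inl]
    fin_cases i <;> fin_cases k <;> fin_cases x₁ <;> fin_cases x₂ <;> fin_cases l <;>
      fin_cases l' <;> simp [matMulTensor, starB]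
  · simp [starB]
  · simp [starB]
  · rw [weightedStar_inr_inr, mul_ne_zero_iff, and_iff_right (hw _)]
    fin_cases i <;> fin_cases k <;> fin_cases x₁ <;> fin_cases x₂ <;> fin_cases l <;>
      fin_cases l' <;> simp [matMulTensor, starB]

/-- **`supp 𝔖^{wᵀ} = tstarSupp`** for `w` nowhere zero. [cite: CohnUmans2013, §3] -/
theorem weightedTStar_ne_zero_iff {w : Mid → ℂ} (hw : ∀ b, w b ≠ 0) (a : Leaf) (b : Mid)
    (c : Leaf) : weightedTStar ℂ 2 1 w a b c ≠ 0 ↔ (a, b, c) ∈ tstarSupp := by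
  rw [mem_tstarSupp]
  obtain ⟨x₁, x₂⟩ := b
  rcases a with ⟨i, l⟩ | ⟨i, l⟩ <;> rcases c with ⟨k, l'⟩ | ⟨k, l'⟩
  · rw [weightedTStar_inl_inl]
    fin_cases i <;> fin_cases k <;> fin_cases x₁ <;> fin_cases x₂ <;> fin_cases l <;>
      fin_cases l' <;> simp [matMulTensor, tstarB]
  · simp [tstarB]
  · simp [tstarB]
  · rw [weightedTStar_inr_inr, mul_ne_zero_iff, and_iff_right (hw _)]
    fin_cases i <;> fin_cases k <;> fin_cases x₁ <;> fin_cases x₂ <;> fin_cases l <;>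
      fin_cases l' <;> simp [matMulTensor, tstarB]

/-- `x`-labels for `𝔖^w`: `inl i ↦ i`, `inr i ↦ i + 2` (`= i + 2·leaf`). [folklore] -/
def starα : Leaf → ℤ
  | Sum.inl a => ![0, 1] a.1
  | Sum.inr a => ![2, 3] a.1

/-- `X`-labels for `𝔖^w`: `(i,j) ↦ −i + 4j`. [folklore] -/
def starβ : Mid → ℤ := fun b => ![![0, 4], ![-1, 3]] b.1 b.2

/-- `z`-labels for `𝔖^w`: `inl j ↦ −4j`, `inr j ↦ −4j − 2`. [folklore] -/
def starγ : Leaf → ℤ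
  | Sum.inl c => ![0, -4] c.1
  | Sum.inr c => ![-2, -6] c.1

/-- `x`-labels for `𝔖^{wᵀ}`: `inl i ↦ i`, `inr i ↦ 10i + 100`. [folklore] -/
def tstarα : Leaf → ℤ
  | Sum.inl a => ![0, 1] a.1
  | Sum.inr a => ![100, 110] a.1

/-- `X`-labels for `𝔖^{wᵀ}`: `(i,j) ↦ −i − 10j`. [folklore] -/
def tstarβ : Mid → ℤ := fun b => ![![0, -10], ![-1, -11]] b.1 b.2

/-- `z`-labels for `𝔖^{wᵀ}`: `inl j ↦ 10j`, `inr j ↦ j − 100`. [folklore] -/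
def tstarγ : Leaf → ℤ
  | Sum.inl c => ![0, 10] c.1
  | Sum.inr c => ![-100, -99] c.1

/-- **Tightness of `supp 𝔖^w`.** [cite: BurgisserClausenShokrollahi1997, Def. (15.34)] -/
theorem star_tight : ∀ s ∈ starSupp, starα s.1 + starβ s.2.1 + starγ s.2.2 = 0 := by
  decide

/-- **Tightness of `supp 𝔖^{wᵀ}`.** [cite: BurgisserClausenShokrollahi1997, Def. (15.34)] -/
theorem tstar_tight : ∀ s ∈ tstarSupp, tstarα s.1 + tstarβ s.2.1 + tstarγ s.2.2 = 0 := by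
  decide

/-- The labels are injective. [folklore] -/
theorem starα_injective : Function.Injective starα := by decide
/-- The labels are injective. [folklore] -/
theorem starβ_injective : Function.Injective starβ := by decide
/-- The labels are injective. [folklore] -/
theorem starγ_injective : Function.Injective starγ := by decide
/-- The labels are injective. [folklore] -/
theorem tstarα_injective : Function.Injective tstarα := by decide
/-- The labels are injective. [folklore] -/
theorem tstarβ_injective : Function.Injective tstarβ := by decide
/-- The labels are injective. [folklore] -/
theorem tstarγ_injective : Function.Injective tstarγ := by decide

/-- Label bounds. [folklore] -/
theorem abs_starα_le : ∀ a, |starα a| ≤ 110 := by decide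
/-- Label bounds. [folklore] -/
theorem abs_starβ_le : ∀ b, |starβ b| ≤ 110 := by decide
/-- Label bounds. [folklore] -/
theorem abs_tstarα_le : ∀ a, |tstarα a| ≤ 110 := by decide
/-- Label bounds. [folklore] -/
theorem abs_tstarβ_le : ∀ b, |tstarβ b| ≤ 110 := by decide

/-- `|supp 𝔖^w| = 8`. [folklore] -/
theorem card_starSupp : starSupp.card = 8 := by decide
/-- `|supp 𝔖^{wᵀ}| = 8`. [folklore] -/
theorem card_tstarSupp : tstarSupp.card = 8 := by decide

/-- Rows of `supp 𝔖^w` have 2 points (`x`-direction). [folklore] -/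
theorem star_row₁ : ∀ a : Leaf,
    (Finset.univ.filter fun bc : Mid × Leaf => (a, bc.1, bc.2) ∈ starSupp).card = 2 := by decide
/-- Rows of `supp 𝔖^w` have 2 points (`X`-direction). [folklore] -/
theorem star_row₂ : ∀ x : Mid,
    (Finset.univ.filter fun ac : Leaf × Leaf => (ac.1, x, ac.2) ∈ starSupp).card = 2 := by decide
/-- Rows of `supp 𝔖^w` have 2 points (`z`-direction). [folklore] -/
theorem star_row₃ : ∀ c : Leaf,
    (Finset.univ.filter fun ab : Leaf × Mid => (ab.1, ab.2, c) ∈ starSupp).card = 2 := by decide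
/-- Rows of `supp 𝔖^{wᵀ}` have 2 points (`x`-direction). [folklore] -/
theorem tstar_row₁ : ∀ a : Leaf,
    (Finset.univ.filter fun bc : Mid × Leaf => (a, bc.1, bc.2) ∈ tstarSupp).card = 2 := by decide
/-- Rows of `supp 𝔖^{wᵀ}` have 2 points (`X`-direction). [folklore] -/
theorem tstar_row₂ : ∀ x : Mid,
    (Finset.univ.filter fun ac : Leaf × Leaf => (ac.1, x, ac.2) ∈ tstarSupp).card = 2 := by decide
/-- Rows of `supp 𝔖^{wᵀ}` have 2 points (`z`-direction). [folklore] -/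
theorem tstar_row₃ : ∀ c : Leaf,
    (Finset.univ.filter fun ab : Leaf × Mid => (ab.1, ab.2, c) ∈ tstarSupp).card = 2 := by decide

/-- `|Leaf| = 4`. [folklore] -/
theorem card_leaf : Fintype.card Leaf = 4 := by rfl

/-- `|Mid| = 4`. [folklore] -/
theorem card_mid : Fintype.card Mid = 4 := by rfl

end Supports

end Summit.MatrixMultiplication.MatrixMultiplication.Theorems.FarEdgeDescentStratumPinning

end
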